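import Summits.QuantumFields.BalabanUV.T4Continuum.Support.DirichletHoleFillingCutoff

/-!
# `BalabanUV.T4Continuum.Support.DirichletHoleFilling` — NE2 (node U1a) formalisation swarm, sub-row `T4-U1a.S-NE2-D1-DIRICHLET°`,
# supplier item «Δ1-HOLEFILL» (brick H-C, part 1b of 2): WIDMAN'S HOLE-FILLING STEP ON THE LATTICE — at a corner of a block on which the
# field vanishes, the Dirichlet energy in the cube of side `2k` is at most `θ_d < 1` times the energy in the concentric cube of side `4k`,
# plus a source term; `θ_d` EXPLICIT and free of `k`, of the torus and of the field (unit b2b-balaban-t4-ne2-formalise-leaf-08, gen 6, file 4b)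

HONEST FRAMING.  Rung (B)+1 bookkeeping at MODEL level (finite torus, one lattice field); [folklore] lattice De Giorgi–Widman; NE2 (U1a) is
NOT proved by this file; spine PROVED 0/9 unchanged; NOT infinite volume, NOT the mass gap, NOT Clay.  HONEST DEPENDENCY (verbatim):
«continuum YM on T⁴ ⇐ BetaPertH ∧ nine spine estimates (0/9 proved); BetaPertH ⇐ (D1) ∧ (D4) ∧ CAP+tail; G-an2-4 gates asym, D1 and NE2/3/4.»

WHAT THIS FILE PROVES (0 sorry).  Torus `Tor N`, lattice factor `c ≠ 0`, `∂_ν = c(S_ν − 1)`, `Δ = Σ ∂ᴴ∂` (`B5Action121`); chart, ramp and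
cutoff `η` from `DirichletHoleFillingCutoff`:
 * `eta_diff`: the bond difference of `η` is the push-forward of the bond differences of `ψ` (first ∕ last layers carry `ψ = 0`);
 * (L) `lower_bound`: `‖c‖²·dirOn (inner k) F ≤ Σ_ν Σ_x η(x+e_ν)²‖∂_ν z(x)‖²` (`η = 1` on the inner cube); (E) `error_bound`: the transition mass
   `Σ_ν Σ_x (δ_νη)²(7∕2‖z‖² + ½‖z₊‖²) ≤ 4/(k−1)²·(mass of F on the 2d slabs)`; (S) `source_bound`: `Re⟨η²z, 1_ΩΔz⟩ ≤ √(Σ‖F‖²)·√(Σ‖1_ΩΔz∘chart‖²)`;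
 * **`hole_filling_step`**: for `d ≥ 2`, `k ≥ 2`, `4k = n + 1 ≤ N ν`, `z` supported in `Ω` and VANISHING ON THE CHART OCTANT `oct σ k` (in the
   application: the exterior unit block at a boundary vertex), with `F = z ∘ chart b`:
   `dirOn (inner k) F ≤ θ_d · dirOn univ F + 16(1 + 2^d)·k²/‖c‖⁴ · Σ_j ‖(1_Ω Δ z)(chart b j)‖²`, `θ_d = (1 + 4K_d)/(2 + 4K_d) < 1`,
   `K_d = 128·d·annConst d` — H-A `DirichletCaccioppoli.caccioppoli_region` BY NAME with the cutoff `η`, H-B `CoordAnnulusPoincare.annulus_mass_le`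
   + `slabs_dir_le` (slab mass ≤ annConst·P·d·(energy outside the inner cube), `P = n(n+1)/2 ≤ 8k²`, `4P/(k−1)² ≤ 128`), the source by
   `CoordOctantBoxes.sum_norm_sq_cube_le` + Cauchy–Schwarz + Young (`√X√M ≤ (tX + M/t)/2`, `t = ‖c‖²/(2(1+2^d)P)`), then «fill the hole»:
   `(½ + K)·D_in ≤ (¼ + K)·D_out + source`.

WHY (memo `t4/T4-EST-NE2-D1-LOCAL.md` §5).  Iterated over dyadic cubes (file 5, `DirichletMorreyDecay`) this is Morrey decay
`E(z; cube ρ) ≲ (ρ/ρ₀)^{2s_d}`, `s_d = ½·log₂ θ_d⁻¹ > 0`, at every boundary vertex of every union of unit blocks — the input that bounds the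
near-vertex piece of the second-difference budget at the located residue of «Δ1-LOCAL» (conflict patches) trivially.  The rate is honest and
tiny (constants generous, not optimised); the point is that it is POSITIVE, EXPLICIT and GEOMETRY-FREE.

ABSOLUTE RULE (cell, verbatim): «No internally-minted statement may enter as a cited fact. Every hypothesis is either kernel-proved in
this package or a verbatim quotation of a PUBLISHED theorem with page reference. The manuscript(s) under audit are NOT citable for
their own disputed steps — they are the thing under adjudication; programme-internal (2001/route/tribunal) claims are never citable.»
[folklore]; plain data `def`s (`sdn`, `Kd`, `theta`), no `def … : Prop` fact.  NOT CLAIMED: anything at the residue beyond this decay input;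
the two-level law on conflict patches; NE2; NE3.
-/

noncomputable section

open scoped BigOperators ComplexConjugate Matrix
open Finset

namespace Summit.QuantumFields.BalabanUV.T4Continuum.DirichletHoleFilling

open Literature.MathematicalPhysics.QuantumFieldTheory.Balaban1983to89.B5Prop11Plancherel (Tor unitVec)
open Literature.MathematicalPhysics.QuantumFieldTheory.Balaban1983to89.B5Action121 (sdiff LapS sdiff_mulVec)
open Literature.MathematicalPhysics.QuantumFieldTheory.Balaban1983to89.Beta.CoordCubePoincare (stepUp)
open Summit.QuantumFields.BalabanUV.T4Continuum.DirichletDirectionalBesov (star_dotProduct_eq_sum restrictTo)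
open Summit.QuantumFields.BalabanUV.T4Continuum.DirichletDirectionalBesovCutoff (cut)
open Summit.QuantumFields.BalabanUV.T4Continuum.DirichletCaccioppoli (caccioppoli_region)
open Summit.QuantumFields.BalabanUV.T4Continuum.FiniteVarianceGluing (sum_union_le_add)
open Summit.QuantumFields.BalabanUV.T4Continuum.CoordSlabPoincare
open Summit.QuantumFields.BalabanUV.T4Continuum.CoordSlabPoincareHi (hi mem_hi)
open Summit.QuantumFields.BalabanUV.T4Continuum.CoordOctantBoxes (oct sum_norm_sq_cube_le)
open Summit.QuantumFields.BalabanUV.T4Continuum.CoordAnnulusPoincare (inner mem_inner slabDir annConst annulus_mass_le slabs_dir_le)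
open Summit.QuantumFields.BalabanUV.T4Continuum.DirichletHoleFillingCutoff

variable {d : ℕ} (N : Fin d → ℕ) [hN : ∀ μ, NeZero (N μ)] {n : ℕ}

/-! ## §3 The hole-filling step -/

section Step

variable (k : ℕ) (b : Tor N)

/-- one step DOWN in direction `ν` (used only for `j ν ≠ 0`). [folklore] -/
def sdn (ν : Fin d) (j : Fin d → Fin (n + 1)) : Fin d → Fin (n + 1) := Function.update j ν (mkF (n := n) ((j ν : ℕ) - 1))

omit hN in
/-- `sdn` undoes `stepUp`. [folklore] -/
theorem sdn_stepUp {ν : Fin d} {j : Fin d → Fin (n + 1)} (hj : j ν ≠ Fin.last n) : sdn (n := n) ν (stepUp j ν) = j := by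
  have hv := val_stepUp hj
  refine ext_of_digit ν ?_ fun l hl => by rw [sdn, Function.update_of_ne hl, stepUp_apply_ne _ hl]
  rw [sdn, Function.update_self, val_mkF_of_lt (by have := (stepUp j ν ν).isLt; omega), hv]; omega

omit hN in
/-- `stepUp` undoes `sdn` off the first layer. [folklore] -/
theorem stepUp_sdn {ν : Fin d} {j : Fin d → Fin (n + 1)} (hj : (j ν : ℕ) ≠ 0) : stepUp (sdn (n := n) ν j) ν = j := by
  have hlt := (j ν).isLt
  have hv : ((sdn (n := n) ν j ν : Fin (n + 1)) : ℕ) = (j ν : ℕ) - 1 := by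
    rw [sdn, Function.update_self, val_mkF_of_lt (by omega)]
  have hne : sdn (n := n) ν j ν ≠ Fin.last n := by
    intro h; have := congrArg Fin.val h; rw [Fin.val_last, hv] at this; omega
  refine ext_of_digit ν ?_ fun l hl => by rw [stepUp_apply_ne _ hl, sdn, Function.update_of_ne hl]
  rw [val_stepUp hne, hv]; omega

omit hN in
/-- **THE BOND DIFFERENCE OF `η`** is the push-forward of the bond differences of `ψ`:
`η (x + e_ν) − η x = Σ_{j : j ν ≠ last} [chart j = x]·(ψ (j + e_ν) − ψ j)`. [folklore] -/
theorem eta_diff (hk : 2 ≤ k) (hn : 4 * k = n + 1) (ν : Fin d) (x : Tor N) :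
    eta N (n := n) k b (x + unitVec N ν) - eta N (n := n) k b x
      = ∑ j ∈ univ.filter (fun j : Fin d → Fin (n + 1) => j ν ≠ Fin.last n),
          (if chart N b j = x then psi (n := n) k (stepUp j ν) - psi k j else 0) := by
  set A : Finset (Fin d → Fin (n + 1)) := univ.filter (fun j : Fin d → Fin (n + 1) => j ν ≠ Fin.last n) with hA
  -- `η (x + e_ν)`: drop the first layer (`ψ = 0` there), reindex the rest by `stepUp`
  have h1 : eta N (n := n) k b (x + unitVec N ν) = ∑ j ∈ A, (if chart N b j = x then psi (n := n) k (stepUp j ν) else 0) := by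
    rw [eta, ← Finset.sum_filter_add_sum_filter_not univ (fun j : Fin d → Fin (n + 1) => (j ν : ℕ) = 0)]
    have hz : ∑ j ∈ univ.filter (fun j : Fin d → Fin (n + 1) => (j ν : ℕ) = 0),
        (if chart N b j = x + unitVec N ν then psi (n := n) k j else 0) = 0 := by
      refine Finset.sum_eq_zero fun j hj => ?_
      rw [mem_filter] at hj
      rw [psi_eq_zero_of_zero k hk hj.2]; split_ifs <;> rfl
    rw [hz, zero_add]
    symm
    refine Finset.sum_nbij' (fun j => stepUp j ν) (sdn ν) ?_ ?_ ?_ ?_ ?_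
    · intro j hj; rw [hA, mem_filter] at hj; rw [mem_filter, val_stepUp hj.2]; exact ⟨mem_univ _, by omega⟩
    · intro j hj; rw [mem_filter] at hj
      have hv : ((sdn (n := n) ν j ν : Fin (n + 1)) : ℕ) = (j ν : ℕ) - 1 := by
        rw [sdn, Function.update_self, val_mkF_of_lt (by have := (j ν).isLt; omega)]
      rw [hA, mem_filter]; refine ⟨mem_univ _, fun h => ?_⟩
      have := congrArg Fin.val h; rw [Fin.val_last, hv] at this; have := (j ν).isLt; omega
    · intro j hj; rw [hA, mem_filter] at hj; exact sdn_stepUp hj.2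
    · intro j hj; rw [mem_filter] at hj; exact stepUp_sdn hj.2
    · intro j hj; rw [hA, mem_filter] at hj
      rw [chart_stepUp N b hj.2]
      by_cases h : chart N b j = x
      · rw [if_pos h, if_pos (by rw [h])]
      · rw [if_neg h, if_neg (fun h' => h (add_right_cancel h'))]
  -- `η x`: drop the last layer
  have h2 : eta N (n := n) k b x = ∑ j ∈ A, (if chart N b j = x then psi (n := n) k j else 0) := by
    rw [eta, ← Finset.sum_filter_add_sum_filter_not univ (fun j : Fin d → Fin (n + 1) => j ν ≠ Fin.last n)]
    have hz : ∑ j ∈ univ.filter (fun j : Fin d → Fin (n + 1) => ¬ j ν ≠ Fin.last n),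
        (if chart N b j = x then psi (n := n) k j else 0) = 0 := by
      refine Finset.sum_eq_zero fun j hj => ?_
      rw [mem_filter, not_not] at hj
      rw [psi_eq_zero_of_last k hk hn hj.2]; split_ifs <;> rfl
    rw [hz, add_zero]
  rw [h1, h2, ← Finset.sum_sub_distrib]
  refine Finset.sum_congr rfl fun j _ => ?_
  split_ifs <;> ring

variable (c : ℂ) {Ω : Tor N → Prop} [DecidablePred Ω] (z : Tor N → ℂ) (σ : Fin d → Bool)

/-- (L) the left-hand side of Caccioppoli dominates `‖c‖²·dirOn (inner k) (z ∘ chart)` (there `η = 1`). [folklore] -/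
theorem lower_bound (hk : 2 ≤ k) (hn : 4 * k = n + 1) (hN' : ∀ ν, n + 1 ≤ N ν) :
    ‖c‖ ^ 2 * dirOn (inner (n := n) k) (z ∘ chart N b)
      ≤ ∑ ν : Fin d, ∑ x : Tor N, eta N (n := n) k b (x + unitVec N ν) ^ 2 * ‖(sdiff N c ν *ᵥ z) x‖ ^ 2 := by
  rw [dirOn, Finset.mul_sum]
  refine Finset.sum_le_sum fun ν _ => ?_
  rw [Finset.mul_sum]
  have h := sum_chart_le_sum N b hN'
    (univ.filter (fun y : Fin d → Fin (n + 1) => y ν ≠ Fin.last n ∧ y ∈ inner (n := n) k ∧ stepUp y ν ∈ inner (n := n) k))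
    (G := fun x => eta N (n := n) k b (x + unitVec N ν) ^ 2 * ‖(sdiff N c ν *ᵥ z) x‖ ^ 2) (fun x => by positivity)
  refine le_trans (le_of_eq ?_) h
  refine Finset.sum_congr rfl fun j hj => ?_
  rw [mem_filter] at hj
  obtain ⟨_, hne, _, hin⟩ := hj
  rw [← chart_stepUp N b hne, eta_chart N k b hN', psi_eq_one_of_inner k hk hn hin, one_pow, one_mul, sdiff_mulVec,
    ← chart_stepUp N b hne, norm_mul, mul_pow, Function.comp_apply, Function.comp_apply]

/-- (E) the transition mass of `η` lives on the `2d` slabs, with weight `(1/(k−1))²`. [folklore] -/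
theorem error_bound (hk : 2 ≤ k) (hn : 4 * k = n + 1) (hN' : ∀ ν, n + 1 ≤ N ν) :
    ∑ ν : Fin d, ∑ x : Tor N, (eta N (n := n) k b (x + unitVec N ν) - eta N (n := n) k b x) ^ 2
        * (7 / 2 * ‖z x‖ ^ 2 + 1 / 2 * ‖z (x + unitVec N ν)‖ ^ 2)
      ≤ 4 / ((k : ℝ) - 1) ^ 2 * ∑ ν : Fin d, (∑ y ∈ lo (n := n) ν k, ‖(z ∘ chart N b) y‖ ^ 2 + ∑ y ∈ hi (n := n) ν k, ‖(z ∘ chart N b) y‖ ^ 2) := by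
  have hk1 : (0 : ℝ) < (k : ℝ) - 1 := by
    have : (2 : ℝ) ≤ k := by exact_mod_cast hk
    linarith
  rw [Finset.mul_sum]
  refine Finset.sum_le_sum fun ν _ => ?_
  set A : Finset (Fin d → Fin (n + 1)) := univ.filter (fun j : Fin d → Fin (n + 1) => j ν ≠ Fin.last n) with hA
  set δ : (Fin d → Fin (n + 1)) → ℝ := fun j => psi (n := n) k (stepUp j ν) - psi k j with hδ
  set F : (Fin d → Fin (n + 1)) → ℂ := z ∘ chart N b with hF
  -- push the torus sum to the cube
  have h1 : ∑ x : Tor N, (eta N (n := n) k b (x + unitVec N ν) - eta N (n := n) k b x) ^ 2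
        * (7 / 2 * ‖z x‖ ^ 2 + 1 / 2 * ‖z (x + unitVec N ν)‖ ^ 2)
      = ∑ j ∈ A, δ j ^ 2 * (7 / 2 * ‖F j‖ ^ 2 + 1 / 2 * ‖F (stepUp j ν)‖ ^ 2) := by
    have hrw : ∀ x : Tor N, (eta N (n := n) k b (x + unitVec N ν) - eta N (n := n) k b x) ^ 2
        = ∑ j ∈ A, (if chart N b j = x then δ j ^ 2 else 0) := fun x => by
      rw [eta_diff N k b hk hn ν x, ← hA, sq_sum_ite N b hN' A δ x]
    simp_rw [hrw]
    rw [sum_pull N b A (fun j => δ j ^ 2) (fun x => 7 / 2 * ‖z x‖ ^ 2 + 1 / 2 * ‖z (x + unitVec N ν)‖ ^ 2)]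
    refine Finset.sum_congr rfl fun j hj => ?_
    rw [hA, mem_filter] at hj
    rw [← chart_stepUp N b hj.2, hF, Function.comp, Function.comp]
  rw [h1]
  -- the bond differences of `ψ` vanish off the slabs and are `≤ 1/(k−1)` on them
  set B : Finset (Fin d → Fin (n + 1)) := A.filter (fun j => (j ν : ℕ) + 1 < k ∨ 3 * k ≤ (j ν : ℕ)) with hB
  have h2 : ∑ j ∈ A, δ j ^ 2 * (7 / 2 * ‖F j‖ ^ 2 + 1 / 2 * ‖F (stepUp j ν)‖ ^ 2)
      ≤ ∑ j ∈ A, (if (j ν : ℕ) + 1 < k ∨ 3 * k ≤ (j ν : ℕ)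
          then (1 / ((k : ℝ) - 1)) ^ 2 * (7 / 2 * ‖F j‖ ^ 2 + 1 / 2 * ‖F (stepUp j ν)‖ ^ 2) else 0) := by
    refine Finset.sum_le_sum fun j hj => ?_
    rw [hA, mem_filter] at hj
    have hm : 0 ≤ 7 / 2 * ‖F j‖ ^ 2 + 1 / 2 * ‖F (stepUp j ν)‖ ^ 2 := by positivity
    split_ifs with hc
    · refine mul_le_mul_of_nonneg_right ?_ hm
      have hab := abs_psi_stepUp_sub_le k hk hn j hj.2
      calc δ j ^ 2 = |psi (n := n) k (stepUp j ν) - psi k j| ^ 2 := by rw [hδ, sq_abs]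
        _ ≤ (1 / ((k : ℝ) - 1)) ^ 2 := pow_le_pow_left₀ (abs_nonneg _) hab 2
    · have h0 : δ j = 0 := by rw [hδ]; exact sub_eq_zero.mpr (psi_stepUp_eq k hk j hj.2 hc)
      rw [h0]; simp
  have h2' : ∑ j ∈ A, (if (j ν : ℕ) + 1 < k ∨ 3 * k ≤ (j ν : ℕ)
          then (1 / ((k : ℝ) - 1)) ^ 2 * (7 / 2 * ‖F j‖ ^ 2 + 1 / 2 * ‖F (stepUp j ν)‖ ^ 2) else 0)
      = ∑ j ∈ B, (1 / ((k : ℝ) - 1)) ^ 2 * (7 / 2 * ‖F j‖ ^ 2 + 1 / 2 * ‖F (stepUp j ν)‖ ^ 2) := by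
    rw [hB]; exact (Finset.sum_filter _ _).symm
  refine (h2.trans (le_of_eq h2')).trans ?_
  rw [← Finset.mul_sum, Finset.sum_add_distrib, ← Finset.mul_sum, ← Finset.mul_sum]
  -- both ends of a `B`-bond lie in the slabs of direction `ν`
  have hsub : B ⊆ lo (n := n) ν k ∪ hi (n := n) ν k := by
    intro j hj; rw [hB, mem_filter] at hj; rw [mem_union, mem_lo, mem_hi]; omega
  have hS1 : ∑ j ∈ B, ‖F j‖ ^ 2 ≤ ∑ y ∈ lo (n := n) ν k, ‖F y‖ ^ 2 + ∑ y ∈ hi (n := n) ν k, ‖F y‖ ^ 2 :=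
    (Finset.sum_le_sum_of_subset_of_nonneg hsub fun _ _ _ => sq_nonneg _).trans (sum_union_le_add (fun _ => sq_nonneg _) _ _)
  have hS2 : ∑ j ∈ B, ‖F (stepUp j ν)‖ ^ 2 ≤ ∑ y ∈ lo (n := n) ν k, ‖F y‖ ^ 2 + ∑ y ∈ hi (n := n) ν k, ‖F y‖ ^ 2 := by
    have hinj : ∀ j ∈ B, ∀ j' ∈ B, stepUp j ν = stepUp j' ν → j = j' := by
      intro j hj j' hj' h
      rw [hB, mem_filter, hA, mem_filter] at hj hj'
      rw [← sdn_stepUp (n := n) hj.1.2, ← sdn_stepUp (n := n) hj'.1.2, h]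
    rw [← Finset.sum_image (f := fun y => ‖F y‖ ^ 2) hinj]
    have hsub2 : B.image (fun j => stepUp j ν) ⊆ lo (n := n) ν k ∪ hi (n := n) ν k := by
      intro y hy
      rw [mem_image] at hy
      obtain ⟨j, hj, rfl⟩ := hy
      rw [hB, mem_filter, hA, mem_filter] at hj
      rw [mem_union, mem_lo, mem_hi, val_stepUp hj.1.2]; omega
    exact (Finset.sum_le_sum_of_subset_of_nonneg hsub2 fun _ _ _ => sq_nonneg _).trans (sum_union_le_add (fun _ => sq_nonneg _) _ _)
  set S := ∑ y ∈ lo (n := n) ν k, ‖F y‖ ^ 2 + ∑ y ∈ hi (n := n) ν k, ‖F y‖ ^ 2 with hSdef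
  have hk1' : (k : ℝ) - 1 ≠ 0 := hk1.ne'
  calc (1 / ((k : ℝ) - 1)) ^ 2 * (7 / 2 * ∑ j ∈ B, ‖F j‖ ^ 2 + 1 / 2 * ∑ j ∈ B, ‖F (stepUp j ν)‖ ^ 2)
      ≤ (1 / ((k : ℝ) - 1)) ^ 2 * (7 / 2 * S + 1 / 2 * S) := mul_le_mul_of_nonneg_left (by linarith) (sq_nonneg _)
    _ = 4 / ((k : ℝ) - 1) ^ 2 * S := by field_simp; ring

/-- Cauchy–Schwarz with a free parameter: `√X·√M ≤ (tX + M/t)/2`. [folklore] -/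
theorem sqrt_mul_sqrt_le {X M t : ℝ} (hX : 0 ≤ X) (hM : 0 ≤ M) (ht : 0 < t) :
    Real.sqrt X * Real.sqrt M ≤ (t * X + M / t) / 2 := by
  have h1 : Real.sqrt X * Real.sqrt M = Real.sqrt (t * X) * Real.sqrt (M / t) := by
    rw [← Real.sqrt_mul hX, ← Real.sqrt_mul (by positivity)]
    congr 1; field_simp
  rw [h1]
  nlinarith [sq_nonneg (Real.sqrt (t * X) - Real.sqrt (M / t)), Real.sq_sqrt (show 0 ≤ t * X by positivity),
    Real.sq_sqrt (show 0 ≤ M / t by positivity)]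

/-- (S) the SOURCE pairing is at most `√(Σ_j ‖z(chart j)‖²)·√(Σ_j ‖(1_ΩΔz)(chart j)‖²)`. [folklore] -/
theorem source_bound (hk : 2 ≤ k) (hn : 4 * k = n + 1) (hN' : ∀ ν, n + 1 ≤ N ν) :
    (star (cut N (fun y => eta N (n := n) k b y ^ 2) z) ⬝ᵥ restrictTo Ω (LapS N c *ᵥ z)).re
      ≤ Real.sqrt (∑ j : Fin d → Fin (n + 1), ‖(z ∘ chart N b) j‖ ^ 2)
        * Real.sqrt (∑ j : Fin d → Fin (n + 1), ‖restrictTo Ω (LapS N c *ᵥ z) (chart N b j)‖ ^ 2) := by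
  set r := restrictTo Ω (LapS N c *ᵥ z) with hr
  rw [star_dotProduct_eq_sum, Complex.re_sum]
  have h1 : ∀ x : Tor N, (conj (cut N (fun y => eta N (n := n) k b y ^ 2) z x) * r x).re
      ≤ (∑ j : Fin d → Fin (n + 1), if chart N b j = x then (1 : ℝ) else 0) * (‖z x‖ * ‖r x‖) := by
    intro x
    have he0 := eta_nonneg N k b hk hn x
    have he1 := eta_le_one N k b hk hn hN' x
    have hind := eta_le_indicator N k b hk hn x
    calc (conj (cut N (fun y => eta N (n := n) k b y ^ 2) z x) * r x).re
        ≤ ‖conj (cut N (fun y => eta N (n := n) k b y ^ 2) z x) * r x‖ := Complex.re_le_norm _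
      _ = eta N (n := n) k b x ^ 2 * (‖z x‖ * ‖r x‖) := by
          rw [norm_mul, Complex.norm_conj, cut, norm_mul, Complex.norm_real, Real.norm_of_nonneg (sq_nonneg _), mul_assoc]
      _ ≤ (∑ j : Fin d → Fin (n + 1), if chart N b j = x then (1 : ℝ) else 0) * (‖z x‖ * ‖r x‖) := by
          refine mul_le_mul_of_nonneg_right ?_ (by positivity)
          nlinarith
  refine (Finset.sum_le_sum fun x _ => h1 x).trans ?_
  rw [sum_pull N b univ (fun _ => (1 : ℝ)) (fun x => ‖z x‖ * ‖r x‖)]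
  simp only [one_mul]
  have h := Real.sum_mul_le_sqrt_mul_sqrt univ (fun j : Fin d → Fin (n + 1) => ‖z (chart N b j)‖) (fun j => ‖r (chart N b j)‖)
  simpa only [Function.comp] using h

/-- the hole-filling RATIO constant `K_d = 128·d·annConst d`. [folklore] -/
def Kd (d : ℕ) : ℝ := 128 * d * annConst d

/-- the CONTRACTION FACTOR `θ_d = (1 + 4K_d)/(2 + 4K_d) < 1`. [folklore] -/
def theta (d : ℕ) : ℝ := (1 + 4 * Kd d) / (2 + 4 * Kd d)

omit hN in
/-- `K_d ≥ 0`. [folklore] -/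
theorem Kd_nonneg (d : ℕ) : 0 ≤ Kd d := by unfold Kd annConst; positivity

omit hN in
/-- `½ ≤ θ_d < 1`. [folklore] -/
theorem theta_lt_one (d : ℕ) : 1 / 2 ≤ theta d ∧ theta d < 1 := by
  have h := Kd_nonneg d
  unfold theta
  constructor
  · rw [div_le_div_iff₀ (by norm_num) (by positivity)]; linarith
  · rw [div_lt_one (by positivity)]; linarith

/-- **WIDMAN'S HOLE-FILLING STEP ON THE LATTICE.**  `d ≥ 2`, `k ≥ 2`, `4k = n + 1 ≤ N ν`; `z` supported in `Ω` and vanishing on the chart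
octant `oct σ k` at the base point `b`.  Then, with `F = z ∘ chart b`,
`dirOn (inner k) F ≤ θ_d·dirOn univ F + 16(1 + 2^d)·k²/‖c‖⁴·Σ_j ‖(1_ΩΔz)(chart b j)‖²`. [folklore] -/
theorem hole_filling_step (hd : 2 ≤ d) (hk : 2 ≤ k) (hn : 4 * k = n + 1) (hN' : ∀ ν, n + 1 ≤ N ν) (hc : c ≠ 0)
    (hz : ∀ x, ¬ Ω x → z x = 0) (hvan : ∀ j ∈ oct (n := n) k σ, z (chart N b j) = 0) :
    dirOn (inner (n := n) k) (z ∘ chart N (n := n) b)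
      ≤ theta d * dirOn univ (z ∘ chart N (n := n) b)
        + 16 * (1 + 2 ^ d) * (k : ℝ) ^ 2 / ‖c‖ ^ 4 * ∑ j : Fin d → Fin (n + 1), ‖restrictTo Ω (LapS N c *ᵥ z) (chart N b j)‖ ^ 2 := by
  have hvanF : ∀ j ∈ oct (n := n) k σ, (z ∘ chart N (n := n) b) j = 0 := hvan
  -- Caccioppoli with the cutoff `η`, the three bounds, the annulus inequality, the bond count
  have hcac := caccioppoli_region N c (η := eta N (n := n) k b) (eta_nonneg N k b hk hn) hz (Ω := Ω)
  have hL := lower_bound N k b c z hk hn hN'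
  have hE := error_bound N k b z hk hn hN'
  have hS := source_bound N k b c z hk hn hN' (Ω := Ω)
  have hA := annulus_mass_le k σ hd hn (z ∘ chart N (n := n) b) hvanF
  have hB := slabs_dir_le k hn (z ∘ chart N (n := n) b)
  have hcube := sum_norm_sq_cube_le hn σ (z ∘ chart N (n := n) b) hvanF
  set F : (Fin d → Fin (n + 1)) → ℂ := z ∘ chart N (n := n) b with hF
  set DI := dirOn (inner (n := n) k) F with hDI
  set DJ := dirOn univ F with hDJ
  set M := ∑ j : Fin d → Fin (n + 1), ‖restrictTo Ω (LapS N c *ᵥ z) (chart N b j)‖ ^ 2 with hM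
  set P := (n : ℝ) * (n + 1) / 2 with hP
  set LH := ∑ ν : Fin d, ∑ x : Tor N, eta N (n := n) k b (x + unitVec N ν) ^ 2 * ‖(sdiff N c ν *ᵥ z) x‖ ^ 2 with hLH
  set ER := ∑ ν : Fin d, ∑ x : Tor N, (eta N (n := n) k b (x + unitVec N ν) - eta N (n := n) k b x) ^ 2
        * (7 / 2 * ‖z x‖ ^ 2 + 1 / 2 * ‖z (x + unitVec N ν)‖ ^ 2) with hER
  set SR := (star (cut N (fun y => eta N (n := n) k b y ^ 2) z) ⬝ᵥ restrictTo Ω (LapS N c *ᵥ z)).re with hSR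
  set AM := ∑ ν : Fin d, (∑ y ∈ lo (n := n) ν k, ‖F y‖ ^ 2 + ∑ y ∈ hi (n := n) ν k, ‖F y‖ ^ 2) with hAM
  have hcpos : 0 < ‖c‖ := norm_pos_iff.mpr hc
  have hc2 : 0 < ‖c‖ ^ 2 := by positivity
  have hk2 : (2 : ℝ) ≤ k := by exact_mod_cast hk
  have hk1 : (0 : ℝ) < (k : ℝ) - 1 := by linarith
  have hnk : (n : ℝ) + 1 = 4 * k := by
    have : ((4 * k : ℕ) : ℝ) = ((n + 1 : ℕ) : ℝ) := by rw [hn]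
    push_cast at this; linarith
  have hDI0 : 0 ≤ DI := dirOn_nonneg _ _
  have hDJ0 : 0 ≤ DJ := dirOn_nonneg _ _
  have hM0 : 0 ≤ M := Finset.sum_nonneg fun _ _ => sq_nonneg _
  have hPk : P ≤ 8 * (k : ℝ) ^ 2 := by
    rw [hP, show (n : ℝ) = 4 * k - 1 by linarith]; nlinarith
  have hP0 : 0 < P := by
    rw [hP, show (n : ℝ) = 4 * k - 1 by linarith]; nlinarith
  have hann0 : 0 ≤ annConst d := by unfold annConst; positivity
  have hK := Kd_nonneg d
  -- (E'): the transition mass is paid by the energy outside the inner cube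
  have hE' : ER ≤ Kd d * (DJ - DI) := by
    refine hE.trans ?_
    have hratio : 4 / ((k : ℝ) - 1) ^ 2 * P ≤ 128 := by
      rw [div_mul_eq_mul_div, div_le_iff₀ (by positivity), hP, show (n : ℝ) = 4 * k - 1 by linarith]
      nlinarith [sq_nonneg ((k : ℝ) - 2)]
    have hsd0 : 0 ≤ slabDir (n := n) k F := CoordAnnulusPoincare.slabDir_nonneg k F
    calc 4 / ((k : ℝ) - 1) ^ 2 * AM ≤ 4 / ((k : ℝ) - 1) ^ 2 * (annConst d * P * slabDir (n := n) k F) :=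
          mul_le_mul_of_nonneg_left hA (by positivity)
      _ = (4 / ((k : ℝ) - 1) ^ 2 * P) * (annConst d * slabDir (n := n) k F) := by ring
      _ ≤ 128 * (annConst d * (d * (DJ - DI))) :=
          mul_le_mul hratio (mul_le_mul_of_nonneg_left hB hann0) (mul_nonneg hann0 hsd0) (by norm_num)
      _ = Kd d * (DJ - DI) := by rw [Kd]; ring
  -- (S'): the source by Poincaré on the cube + Cauchy–Schwarz + Young
  have hS' : SR ≤ ‖c‖ ^ 2 / 4 * DJ + (1 + 2 ^ d) * P / ‖c‖ ^ 2 * M := by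
    refine hS.trans ?_
    have h1 : Real.sqrt (∑ j : Fin d → Fin (n + 1), ‖F j‖ ^ 2) ≤ Real.sqrt ((1 + 2 ^ d) * P * DJ) := Real.sqrt_le_sqrt hcube
    refine (mul_le_mul_of_nonneg_right h1 (Real.sqrt_nonneg _)).trans ?_
    have h2 := sqrt_mul_sqrt_le (X := (1 + 2 ^ d) * P * DJ) (M := M) (t := ‖c‖ ^ 2 / (2 * (1 + 2 ^ d) * P))
      (mul_nonneg (mul_nonneg (by positivity) hP0.le) hDJ0) hM0 (div_pos hc2 (mul_pos (mul_pos two_pos (by positivity)) hP0))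
    refine h2.trans (le_of_eq ?_)
    field_simp
    ring
  -- fill the hole
  have hE'' : ‖c‖ ^ 2 * ER ≤ ‖c‖ ^ 2 * (Kd d * (DJ - DI)) := mul_le_mul_of_nonneg_left hE' hc2.le
  have key : ‖c‖ ^ 2 * DI * (1 / 2 + Kd d) ≤ ‖c‖ ^ 2 * ((1 / 4 + Kd d) * DJ) + (1 + 2 ^ d) * P / ‖c‖ ^ 2 * M := by
    linarith [hcac, hL, hE'', hS']
  have key2 : DI * (1 / 2 + Kd d) ≤ (1 / 4 + Kd d) * DJ + (1 + 2 ^ d) * P / ‖c‖ ^ 4 * M := by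
    refine le_of_mul_le_mul_left ?_ hc2
    have e : ‖c‖ ^ 2 * ((1 / 4 + Kd d) * DJ + (1 + 2 ^ d) * P / ‖c‖ ^ 4 * M)
        = ‖c‖ ^ 2 * ((1 / 4 + Kd d) * DJ) + (1 + 2 ^ d) * P / ‖c‖ ^ 2 * M := by
      field_simp
    rw [e, ← mul_assoc]; exact key
  have hhalf : (0 : ℝ) < 1 / 2 + Kd d := by linarith
  have key3 : DI ≤ (1 / 4 + Kd d) / (1 / 2 + Kd d) * DJ + ((1 + 2 ^ d) * P / ‖c‖ ^ 4 * M) / (1 / 2 + Kd d) := by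
    rw [div_mul_eq_mul_div, ← add_div, le_div_iff₀ hhalf]; exact key2
  have htheta : (1 / 4 + Kd d) / (1 / 2 + Kd d) = theta d := by
    rw [theta, div_eq_div_iff hhalf.ne' (ne_of_gt (by linarith))]; ring
  rw [htheta] at key3
  refine key3.trans (add_le_add le_rfl ?_)
  -- the source coefficient: `P ≤ 8k²`, `1/(½ + K) ≤ 2`
  rw [div_le_iff₀ hhalf]
  have h16 : (1 + 2 ^ d) * P / ‖c‖ ^ 4 * M ≤ 16 * (1 + 2 ^ d) * (k : ℝ) ^ 2 / ‖c‖ ^ 4 * M * (1 / 2) := by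
    rw [show 16 * (1 + 2 ^ d) * (k : ℝ) ^ 2 / ‖c‖ ^ 4 * M * (1 / 2) = (1 + 2 ^ d) * (8 * (k : ℝ) ^ 2) / ‖c‖ ^ 4 * M by ring]
    refine mul_le_mul_of_nonneg_right (div_le_div_of_nonneg_right (mul_le_mul_of_nonneg_left hPk (by positivity)) (by positivity)) hM0
  have hcoef : 0 ≤ 16 * (1 + 2 ^ d) * (k : ℝ) ^ 2 / ‖c‖ ^ 4 * M := mul_nonneg (by positivity) hM0
  have h17 : 16 * (1 + 2 ^ d) * (k : ℝ) ^ 2 / ‖c‖ ^ 4 * M * (1 / 2) ≤ 16 * (1 + 2 ^ d) * (k : ℝ) ^ 2 / ‖c‖ ^ 4 * M * (1 / 2 + Kd d) :=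
    mul_le_mul_of_nonneg_left (by linarith) hcoef
  exact h16.trans h17

end Step

end Summit.QuantumFields.BalabanUV.T4Continuum.DirichletHoleFilling

end
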